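import Mathlib
import HarnessLib
import Summits.ResolutionOfSingularities.ResolutionOfSingularities.Theorems.WildQuotientsWildQuotientResolutionS1aBlowupNodeAtlas
import Summits.ResolutionOfSingularities.ResolutionOfSingularities.Theorems.WildQuotientsWildQuotientResolutionS1aPrincipalCentre
import Summits.ResolutionOfSingularities.ResolutionOfSingularities.Theorems.WildQuotientsWildQuotientResolutionS1aNodeChartFiniteType
import Summits.ResolutionOfSingularities.ResolutionOfSingularities.Theorems.WildQuotientsWildQuotientResolutionS1aGoodOfKilledNode
import Summits.ResolutionOfSingularities.ResolutionOfSingularities.Theorems.WildQuotientsWildQuotientResolutionS1aGameFrame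
import Summits.ResolutionOfSingularities.ResolutionOfSingularities.Theorems.WildQuotientsWildQuotientResolutionS1aKillCentreGood

/-!
# S1a — (T2e, N6, principal form) over a PRINCIPAL-centre chart every point of the move is GOOD

[OURS · L1 W4.5c · lead-1 g7; CHAIN v10.3 §4 «(T2)-CONSUMER lemma», T2-THEOREM-SHEET §11, T2E-BRIEF (N6)] — NOT statements of the
manuscript; counted 0; AI-level work, weaker than expert review. Crux stmt-ResolutionOfSingularities-17941, line `s1a-logminvertex` v6,
stub `stub_winningStrategy` ((R0) branch).

* **`exists_killedNode_of_isPrincipalCentreChart`** — A5bʼs centre-chart construction (`exists_isNodeChart_of_isCentreChart`, steps 1–8 verbatim,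
  for an arbitrary equivariant action `ρʼ` on the blow-up) over a PRINCIPAL-centre chart (`NodeAtlas.IsPrincipalCentreChart`, `…S1aPrincipalCentre`),
  with two more outputs: the node `(R^w[(y_j T^{d̄})⁻¹], 𝒜ʼ, σʼ = sigmaChart)` is KILLED — `augmentationIdeal σʼ` principal, by
  HYPOTHESIS (the chart predicate) — and of finite type over the Noetherian base `Spec R₀` over which `G` acts
  (`exists_baseRingHom_of_nodeChart`, `finiteType_ofBase_comp`);
* **`GameFrame.GModel.isGoodAt_of_isPrincipalCentreChart`** — hence, for `G = ⟨g₀⟩` of prime order acting over a Noetherian affine base of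
  finite type, EVERY point of a move `Mʼ` of `M` lying over a kill-centre chart is GOOD in `Mʼ` (`isGoodAt_of_killedNode`: the invariant
  node + global Király–Lütkebohmert). This is the certified ONE-MOVE KILL of the (R0) centre rule.
-/

set_option linter.dupNamespace false

noncomputable section

open CategoryTheory AlgebraicGeometry TopologicalSpace Polynomial
open Literature.AlgebraicGeometry.Resolution Literature.AlgebraicGeometry.RelativeSpec
open Summit.ResolutionOfSingularities.ResolutionOfSingularities.Theorems.WildQuotientResolution.S1
open Summit.ResolutionOfSingularities.ResolutionOfSingularities.Theorems.WildQuotientResolution.S1.ProducerStep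
open Summit.ResolutionOfSingularities.ResolutionOfSingularities.Theorems.WildQuotientResolution.S1.CoarseChart
open Summit.ResolutionOfSingularities.ResolutionOfSingularities.Theorems.WildQuotientResolution.S1.NodeAtlas
open Summit.ResolutionOfSingularities.ResolutionOfSingularities.Theorems.WildQuotientResolution.S1.MoveStep
open Summit.ResolutionOfSingularities.ResolutionOfSingularities.Theorems.WildQuotientResolution.S1.InvariantsRegular
open Summit.ResolutionOfSingularities.ResolutionOfSingularities.Theorems.WildQuotientResolution.BlowupExit

namespace Summit.ResolutionOfSingularities.ResolutionOfSingularities.Theorems.WildQuotientResolution.S1.BlowupCharts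

universe u

section Kill

variable {V' V Y : Scheme.{u}} {π : V' ⟶ V} {q : V ⟶ Y} {I : V.IdealSheafData} {G : Type u} [Group G]
  (ρ : ActionOver q G) (hπ : IsBlowup π I) (hρ : ∀ g : G, I.comap (ρ.aut g).hom = I)
  {r' : V' ⟶ Y} (ρ' : ActionOver r' G) (hcomm : ∀ g : G, (ρ'.aut g).hom ≫ π = π ≫ (ρ.aut g).hom)
  {p : ℕ} (g₀ : G)

include hπ hρ hcomm in
/-- **A PRINCIPAL-centre chart lifts to a KILLED node chart of finite type.** Steps 1–8 = `exists_isNodeChart_of_isCentreChart` (for any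
equivariant action `ρʼ` on the blow-up, over `rʼ = π ≫ q`); step 9: the node is killed (hypothesis of the chart predicate);
step 10: finite type over the `G`-invariant Noetherian base `Spec R₀`. [OURS · L1 W4.5c] -/
theorem exists_killedNode_of_isPrincipalCentreChart (hr' : r' = π ≫ q) (hp : p.Prime) (hG : ∀ g : G, g ∈ Subgroup.zpowers g₀)
    (𝒦 : ReesFiltration V) (d : ℕ) (hI : I = 𝒦.ideal d)
    (O : ρ.StableAffineOpens) (hkill : IsPrincipalCentreChart p ρ g₀ 𝒦 d O)
    {R₀ : Type u} [CommRing R₀] (s : V ⟶ Spec (.of R₀)) [LocallyOfFiniteType s]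
    (hs : ∀ g : G, (ρ.aut g).hom ≫ s = s) (v' : V') (hv' : π.base v' ∈ O.1) :
    ∃ O' : ρ'.StableAffineOpens, v' ∈ O'.1 ∧ IsAffineOpen O'.1 ∧
      ∃ (m : ℕ) (r : Fin m → ℕ) (B' : Type u) (_ : CommRing B') (𝒜' : (Π j : Fin m, ZMod (r j)) → AddSubgroup B')
        (_ : GradedRing 𝒜') (σ' : B' ≃+* B') (e' : Γ(V', O'.1) ≃+* ↥(𝒜' 0)),
        IsTameNode p B' 𝒜' σ' ∧
        (∀ t : Γ(V', O'.1),
          ((e' ((ρ'.aut g₀⁻¹).hom.appLE O'.1 O'.1 (O'.2.1 g₀⁻¹).ge t) : ↥(𝒜' 0)) : B') = σ' ((e' t : ↥(𝒜' 0)) : B')) ∧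
        (augmentationIdeal σ').IsPrincipal ∧
        ∃ φ₀ : R₀ →+* B', φ₀.FiniteType ∧ (∀ a, σ' (φ₀ a) = φ₀ a) ∧ ∀ a, φ₀ a ∈ 𝒜' 0 := by
  classical
  obtain ⟨hO, m, r, B, _, 𝒜, _, σ, e, htame, hσ, c, f, δ, w, -, hf, hw, hK1, hK1', hσJ, h𝒦O, hver, hprin⟩ := hkill
  obtain ⟨-, -, hT1, hT2, hσ𝒜, hσp⟩ := id htame
  have hp0 : 0 < p := hp.pos
  -- Step 1: a σ-invariant normalised cover, of Veronese degree `dbar = d * k`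
  obtain ⟨dbar, hdbar, ⟨k, hk⟩, L, y, hy, hσy, hrad⟩ :=
    exists_normalised_cover 𝒜 f w σ hp0 hσ𝒜 hσp hT1 (coverClause_of_sigma_norms 𝒜 σ p hp0 hσ𝒜 hσp f δ w hf hw hσJ)
      d hver.1
  have hk0 : k ≠ 0 := by rintro rfl; rw [mul_zero] at hk; exact hdbar.ne' hk
  have hverbar : VeroneseNormalised 𝒜 f w dbar := by
    rw [hk]; exact veroneseNormalised_mul 𝒜 f w hver (Nat.pos_of_ne_zero hk0)
  -- Step 2: `π` blows up `I ^ k`, whose sections over `O` are `e⁻¹ K_{dbar}`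
  have hπ' : IsBlowup π (I ^ k) := isBlowup_pow hπ hk0
  have hJ' : (I ^ k).ideal ⟨O.1, hO⟩ =
      ((traceFiltration 𝒜 f w).ideal dbar).comap (e : Γ(V, O.1) →+* ↥(𝒜 0)) := by
    rw [Scheme.IdealSheafData.ideal_pow, Pi.pow_apply, hI, ← ReesFiltration.filtration_ideal, h𝒦O d, hk, hver.2 k,
      comap_equiv_pow]
  -- Step 3: the sections `e⁻¹ y_j`
  have hb : ∀ j, e.symm (y j) ∈ (I ^ k).ideal ⟨O.1, hO⟩ := fun j => by
    rw [hJ', Ideal.mem_comap, RingHom.coe_coe, e.apply_symm_apply]; exact hy j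
  -- Step 4: the principal charts `V'[O, e⁻¹ y_j]` cover `π⁻¹ O`
  have hradO : ∀ (b' : Γ(V, O.1)) (hb' : b' ∈ (I ^ k).ideal ⟨O.1, hO⟩),
      reesT b' hb' ∈ (Ideal.span (Set.range fun j => reesT (e.symm (y j)) (hb j))).radical := by
    intro b' hb'
    have hx : e b' ∈ (traceFiltration 𝒜 f w).ideal dbar := by
      rw [hJ', Ideal.mem_comap] at hb'; exact hb'
    have h1' := reesT_mem_radical_span 𝒜 f w dbar y hy hf hverbar hrad (e b') hx
    have hJle : ((traceFiltration 𝒜 f w).ideal dbar).map (e.symm : ↥(𝒜 0) →+* Γ(V, O.1)) ≤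
        (I ^ k).ideal ⟨O.1, hO⟩ := by
      rw [Ideal.map_coe, hJ', Ideal.comap_coe, Ideal.map_symm]
    have hb'' : e.symm (e b') ∈ (I ^ k).ideal ⟨O.1, hO⟩ := by rw [e.symm_apply_apply]; exact hb'
    have h2 := reesT_mem_radical_span_of_equiv e ((I ^ k).ideal ⟨O.1, hO⟩) ((traceFiltration 𝒜 f w).ideal dbar)
      hJle y hy hb (e b') hx hb'' h1'
    have key : ∀ (a : Γ(V, O.1)) (ha : a ∈ (I ^ k).ideal ⟨O.1, hO⟩), a = b' →
        reesT a ha ∈ (Ideal.span (Set.range fun j => reesT (e.symm (y j)) (hb j))).radical →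
        reesT b' hb' ∈ (Ideal.span (Set.range fun j => reesT (e.symm (y j)) (hb j))).radical := by
      rintro _ _ rfl h; exact h
    exact key _ hb'' (e.symm_apply_apply b') h2
  have hcovW : ⨆ j, blowupChart π (I ^ k) ⟨O.1, hO⟩ (e.symm (y j)) = π ⁻¹ᵁ O.1 :=
    IsBlowup.iSup_blowupChart_of_radical hπ' (U := ⟨O.1, hO⟩) (fun j => e.symm (y j)) hb hradO
  -- Step 5: locate `v'`
  have hv'W : v' ∈ ⨆ j, blowupChart π (I ^ k) ⟨O.1, hO⟩ (e.symm (y j)) := by rw [hcovW]; exact hv'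
  obtain ⟨j, hj⟩ := Opens.mem_iSup.mp hv'W
  -- Step 6: the chart `W = V'[O, x]`, `x = e⁻¹ y_j`
  have hxJ : e.symm (y j) ∈ (I ^ k).ideal ⟨O.1, hO⟩ := hb j
  have hxy : e (e.symm (y j)) = y j := e.apply_symm_apply (y j)
  have hWaff : IsAffineOpen (blowupChart π (I ^ k) ⟨O.1, hO⟩ (e.symm (y j))) := hπ'.isAffineOpen_blowupChart (hb j)
  have hWle : blowupChart π (I ^ k) ⟨O.1, hO⟩ (e.symm (y j)) ≤ π ⁻¹ᵁ O.1 :=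
    blowupChart_le_preimage π (I ^ k) ⟨O.1, hO⟩ (e.symm (y j))
  -- `x` is fixed by `G = ⟨g₀⟩`
  have hfix₀ : (ρ.aut g₀⁻¹).hom.appLE O.1 O.1 (O.2.1 g₀⁻¹).ge (e.symm (y j)) = e.symm (y j) := by
    apply e.injective
    apply Subtype.ext
    rw [hσ (e.symm (y j)), hxy]
    exact hσy j
  have hfix : ∀ g : G, (ρ.aut g).hom.appLE O.1 O.1 (O.2.1 g).ge (e.symm (y j)) = e.symm (y j) := fun g =>
    appLE_aut_eq_self_of_mem_zpowers ρ O.1 O.2.1 hfix₀ (by rw [Subgroup.zpowers_inv]; exact hG g)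
  have hstabW : ∀ g : G, (ρ'.aut g).hom ⁻¹ᵁ blowupChart π (I ^ k) ⟨O.1, hO⟩ (e.symm (y j)) =
      blowupChart π (I ^ k) ⟨O.1, hO⟩ (e.symm (y j)) := fun g =>
    preimage_blowupChart_eq (ρ'.aut g) (ρ.aut g) (hcomm g) (O.2.1 g) (by rw [comap_pow, hρ g]) (hfix g)
  -- affine over `Y`
  haveI : IsAffineHom ((blowupChart π (I ^ k) ⟨O.1, hO⟩ (e.symm (y j))).ι ≫ r') := by
    haveI : IsAffine (blowupChart π (I ^ k) ⟨O.1, hO⟩ (e.symm (y j)) : V'.Opens) := hWaff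
    haveI : IsAffine (O.1 : V.Opens) := hO
    haveI := O.2.2
    have : (blowupChart π (I ^ k) ⟨O.1, hO⟩ (e.symm (y j))).ι ≫ r' =
        π.resLE O.1 (blowupChart π (I ^ k) ⟨O.1, hO⟩ (e.symm (y j))) hWle ≫ (O.1.ι ≫ q) := by
      rw [hr', ← Category.assoc, ← Scheme.Hom.resLE_comp_ι π hWle, Category.assoc]
    rw [this]
    infer_instance
  let O' : ρ'.StableAffineOpens := ⟨blowupChart π (I ^ k) ⟨O.1, hO⟩ (e.symm (y j)), hstabW, inferInstance⟩
  refine ⟨O', hj, hWaff, ?_⟩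
  -- Step 7: the node data of the chart ring
  obtain ⟨Ψ, hΨ⟩ := exists_ringEquiv_blowupChart hπ' ⟨O.1, hO⟩ (e.symm (y j)) hxJ
  obtain ⟨𝒜', _, e', htame', he'⟩ :=
    exists_chartNodeData r 𝒜 f w hf dbar (y j) (hy j) σ hσJ hp0 hσp (hσy j) htame hw hK1 hK1' hverbar
  obtain ⟨T, hT⟩ : ∃ T : HomogeneousLocalization.Away (reesGrading ((I ^ k).ideal ⟨O.1, hO⟩)) (reesT (e.symm (y j)) hxJ) ≃+*
      HomogeneousLocalization.Away (reesGrading ((traceFiltration 𝒜 f w).ideal dbar)) (reesT (y j) (hy j)),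
      ∀ s, T (reesChartBase (e.symm (y j)) hxJ s) = reesChartBase (y j) (hy j) (e s) :=
    ⟨awayEquiv e hJ' hxJ (hy j) hxy, awayEquiv_reesChartBase e hJ' hxJ (hy j) hxy⟩
  -- Step 10 (input): the base ring hom of the centre chart
  obtain ⟨φ₀, hφ₀, hφσ, hφ0⟩ := exists_baseRingHom_of_nodeChart ρ g₀ s hs O hO 𝒜 σ e hσ hT2
  refine ⟨m + 1, (Fin.cons 0 r : Fin (m + 1) → ℕ), ChartRing 𝒜 f w dbar (y j) (hy j), inferInstance, 𝒜', inferInstance,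
    sigmaChart 𝒜 f w dbar (y j) (hy j) σ hσJ hp0 hσp (hσy j), (Ψ.trans T).trans e', htame', fun t' => ?_, ?_,
    (ofBase 𝒜 f w dbar (y j) (hy j)).comp φ₀, finiteType_ofBase_comp 𝒜 f w dbar (y j) (hy j) φ₀ hφ₀, fun a => ?_, fun a => ?_⟩
  · -- Step 8: the intertwining (`intertwine`, fed with the pins)
    have hE : ∀ u, ((((Ψ.trans T).trans e') u : ↥(𝒜' 0)) : ChartRing 𝒜 f w dbar (y j) (hy j)) =
        coarseChartMap 𝒜 f w dbar (y j) (hy j) (T (Ψ u)) := fun u => he' (T (Ψ u))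
    refine (hE _).trans (Eq.trans ?_ (congrArg (sigmaChart 𝒜 f w dbar (y j) (hy j) σ hσJ hp0 hσp (hσy j)) (hE t').symm))
    exact intertwine 𝒜 f w dbar (y j) (hy j) σ hσJ hp0 hσp (hσy j) hσ𝒜 e hxJ
      (π.appLE ((⟨O.1, hO⟩ : V.affineOpens) : V.Opens) (blowupChart π (I ^ k) ⟨O.1, hO⟩ (e.symm (y j)))
        (blowupChart_le_preimage π (I ^ k) ⟨O.1, hO⟩ (e.symm (y j)))).hom
      ((ρ'.aut g₀⁻¹).hom.appLE (blowupChart π (I ^ k) ⟨O.1, hO⟩ (e.symm (y j)))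
        (blowupChart π (I ^ k) ⟨O.1, hO⟩ (e.symm (y j))) (hstabW g₀⁻¹).ge).hom
      (fun r => (ρ.aut g₀⁻¹).hom.appLE O.1 O.1 (O.2.1 g₀⁻¹).ge r)
      (fun r => appLE_comm_of_le ρ ρ' hcomm ((⟨O.1, hO⟩ : V.affineOpens) : V.Opens) O.2.1
        (blowupChart π (I ^ k) ⟨O.1, hO⟩ (e.symm (y j))) hstabW
        (blowupChart_le_preimage π (I ^ k) ⟨O.1, hO⟩ (e.symm (y j))) g₀⁻¹ r)
      hσ Ψ hΨ T hT t'
  · -- Step 9: the node is KILLED (hypothesis of the chart predicate)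
    exact hprin hp0 hσp dbar (y j) (hy j) (hσy j) hdbar
  · -- Step 10: `σʼ` fixes the image of `R₀` …
    change sigmaChart 𝒜 f w dbar (y j) (hy j) σ hσJ hp0 hσp (hσy j)
      (algebraMap _ (ChartRing 𝒜 f w dbar (y j) (hy j)) (algebraMap B (↥(cobordantAlgebra f w)) (φ₀ a))) = _
    rw [sigmaChart_algebraMap_algebraMap, hφσ]
    rfl
  · -- … which lies in degree `0`
    have : (ofBase 𝒜 f w dbar (y j) (hy j)).comp φ₀ a =
        ((e' (reesChartBase (y j) (hy j) ⟨φ₀ a, hφ0 a⟩) : ↥(𝒜' 0)) : ChartRing 𝒜 f w dbar (y j) (hy j)) := by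
      rw [he', coarseChartMap_reesChartBase]
      rfl
    rw [this]
    exact (e' _).2

end Kill

end BlowupCharts

/-! ## The game-level statement -/

namespace GameFrame.GModel

variable {p : ℕ} {X' X₁ : Scheme.{0}} {q : X' ⟶ X₁} {G : Type} [Group G] {ρ : G →* Aut X'} {g₀ : G}

/-- **OVER A PRINCIPAL-CENTRE CHART EVERY POINT OF THE MOVE IS GOOD.** `G = ⟨g₀⟩`, `p` prime; `M` a `G`-model of finite type over a
Noetherian affine base `Spec R₀` on which `G` acts trivially; `(𝒦, d)` a `G`-stable centre; `π' : Mʼ.V → M.V` a move (blow-up of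
`𝒦.ideal d`, equivariant); `O` a PRINCIPAL-centre chart of `M`. Then `Mʼ` is GOOD at every point over `O`. [OURS · L1 W4.5c] -/
theorem isGoodAt_of_isPrincipalCentreChart (hp : p.Prime) (hG : ∀ g : G, g ∈ Subgroup.zpowers g₀)
    (M M' : GModel p q G ρ g₀) (𝒦 : ReesFiltration M.V) (d : ℕ)
    (h𝒦G : ∀ (g : G) (n : ℕ), (𝒦.ideal n).comap (M.act.aut g).hom = 𝒦.ideal n)
    (π' : M'.V ⟶ M.V) (hbl : IsBlowup π' (𝒦.ideal d)) (hr : M'.r = π' ≫ M.r)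
    (hcomm : ∀ g : G, (M'.act.aut g).hom ≫ π' = π' ≫ (M.act.aut g).hom)
    (O : M.act.StableAffineOpens) (hkill : IsPrincipalCentreChart p M.act g₀ 𝒦 d O)
    {R₀ : Type} [CommRing R₀] [IsNoetherianRing R₀] (s : M.V ⟶ Spec (.of R₀)) [LocallyOfFiniteType s]
    (hs : ∀ g : G, (M.act.aut g).hom ≫ s = s) (v' : M'.V) (hv' : π'.base v' ∈ O.1) : M'.IsGoodAt v' := by
  obtain ⟨O', hv'O', hO', m, r, B', _, 𝒜', _, σ', e', hnode, he', hI, φ₀, hφ₀, hφσ, hφ0⟩ :=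
    BlowupCharts.exists_killedNode_of_isPrincipalCentreChart M.act hbl (fun g => h𝒦G g d) M'.act hcomm g₀ hr hp hG 𝒦 d rfl O
      hkill s hs v' hv'
  letI : Algebra R₀ B' := φ₀.toAlgebra
  haveI : Algebra.FiniteType R₀ B' := hφ₀
  exact M'.isGoodAt_of_killedNode hG hp v' O' hv'O' hO' r B' 𝒜' σ' e' hnode he' hI hφσ hφ0

end GameFrame.GModel

end Summit.ResolutionOfSingularities.ResolutionOfSingularities.Theorems.WildQuotientResolution.S1

end
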